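import Literature.NumberTheory.Automorphic.UnitaryTwoTorusStandardPosition       -- ★ (this seat) (B6-P)(P1) GENERIC: `exists_gl_conj_eq_torus`, `gl_mul_conj_eq_of_conj_eq`, `companion_zpow_mul_torus_comm`, `exists_gl_det_one_conj_eq_torus_rescale`, `exists_mem_unitaryGroupOfForm_conj_descent_eq`
import Literature.NumberTheory.Automorphic.RamifiedPlaceEisensteinBasis           -- ★ B-p17 (g25) (CM0): `exists_eq_toPlace_add_toPlace_mul` (`L_w = ι L⁺_v ⊕ ι L⁺_v·τ`), `valued_toPlace_eq_sq_of_ramified`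
import Literature.NumberTheory.Automorphic.SLTwoTreeQuadraticTorusShellIndexCount  -- ★ A-p01 (g21) (W′1)-V: `exists_coe_eq_regRep_of_mem_centralizer_companion` (commuting with `γ_τ` ⇒ torus shape)
import Literature.NumberTheory.Rogawski1990.RankOneTorusDepthContinuity             -- ★ F0P3a-p03 (g12) torus pack: `isRegularElt_iff_frameEntry_ne` (+ the frame API on the `cmDatum` carriers)
import Literature.NumberTheory.Rogawski1990.RankOneKappaOrbitalDepthExpansionH      -- ★ A-p13 (g32): `coe_localNonsplitEquiv_mul_map_eq` (the frame read at `w`)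
import HarnessLib

/-!
# (B6-P)(P1) — EXISTENCE OF THE STANDARD-POSITION CONJUGATOR for an elliptic regular torus of `H_v = U(Φ₂)_v × U(Φ₁)_v` at a RAMIFIED place
# (road «W′» = «R1LL-WILD»; Labesse–Langlands 1979 §2 p. 7; Serre, *Trees* II.1.2–1.3; Rogawski 1990 §3.6, §4.9)

Topic `NumberTheory/Rogawski1990`; namespace `Literature.NumberTheory.Rogawski1990`.  THEOREMS ONLY (no definition, no instance, no notation, no named fact, no `sorry`);
kernel lane.  Cell `pub/hodgecm-mathlib` (D-0151), crux H413 = `stmt-HodgeConjecture-24833`, line «N6nsGerm» stub `stub_N6nsR1ramWild`, road «W′» (LEAD F0P3a-plan (g10)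
WORD T9-25; architect A-p16 (g28) RULINGS A-44 (the (γ) layer ★ p844134 and its four sockets), A-45 (A-p13 (g32)'s FLAG «POSITION OF THE TORUS»: (B6-H) ★ p844241∕ED. 2,
(B6-V) and (B6) carry the shared binder `hpos` «`t₀` in standard position w.r.t. the Eisenstein datum»; (B6-P) = the reduction of ARBITRARY frames to standard position,
SPLIT 12:13Z into (P1) EXISTENCE = this file, seat A-p12 (g20), and (P2) TRANSPORT = ★ p844250 B-p14 (g33) `core_of_core_conj`); HEAD = F0P3a-p03 (g13)
`rankOneUnstable_core_ramified_wild := core_of_core_conj ∘ (P1) ∘ …_of_pos`.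
HONEST LABEL: HC_CM is proved only modulo the cell's 2 remaining named inputs (hLiu418, h413) until rung 0 closes; this file is unconditional local algebra (no letter is paid
here by itself) and cites print for orientation only.

THE MATHEMATICS.  `F = L⁺_v`, `E = L_w` (`w ∣ v` ramified, `c • w = w`), `ι = toPlace v w`, `σ = σ_w`, `U_w = U(σ_w, (Φ₂)_w)`, `E₂ : U(Φ₂)_v ≃ U_w` the one-place model over
★ `localNonsplitEquiv` (binder `hE₂`, as in ★ p844041 ∕ ★ p844134), `α ∈ E` skew (`σα = −α ≠ 0`), and a quadratic datum `(τ; u₀, v₀)` with `τ` a UNIFORMISER of `E`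
(`τ + στ = ι u₀`, `τ στ = −ι v₀` — B-p17 (g25) ★ `exists_eisensteinBasis_of_ramified`, clauses 3–4).  For an elliptic regular frame `(t₀, P, d)` (`t₀.1` regular,
`t₀.1 P = P diag(d)`, `c(dᵢ) dᵢ = 1`): the element `y := E₂ t₀.1 ∈ U_w` descends (★ `descent_of_mem_unitaryGroupOfForm_antidiag`) as `diag(1,α) y diag(1,α)⁻¹ = s·ι(g₀)`
and is diagonalised at `w` by `P_w` with eigenvalues `(dᵢ)_w`, distinct (★ `isRegularElt_iff_frameEntry_ne`) and of `σ_w`-norm one; ★ GENERIC `exists_gl_conj_eq_torus` gives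
`h g₀ h⁻¹ = (a, b v₀; b, a + b u₀)`, `b ≠ 0`; twisting by `γ_τ^k`, `γ_τ = (0, v₀; 1, u₀)`, `k := log|det h|` (`|det γ_τ| = |v₀| = |τ|²∕… = |ϖ_v|`: `valued_eq_exp_neg_one_of_norm`)
makes `c := det(γ_τ^k h)` a UNIT; ★ `exists_gl_det_one_conj_eq_torus_rescale` trades it for a determinant-one conjugator into the torus of the RESCALED datum
`(ι c·τ; c u₀, c² v₀)` (still Eisenstein: ★ A-p01 (g22) `eisensteinBasis_rescale`), which LIFTS to `z ∈ U_w` (★ `exists_mem_unitaryGroupOfForm_conj_descent_eq`); with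
`ĝ := E₂⁻¹ z`, EVERY `t` of the conjugated torus `Z((ĝ,1) t₀ (ĝ,1)⁻¹)` descends into Labesse–Langlands' torus of the rescaled datum (commuting with the generator ⇒ the
descent commutes with `a·1 + b′·γ′`, `b′ ≠ 0`, hence with `γ′ = (0, c²v₀; 1, c u₀)` ⇒ torus shape by ★ `exists_coe_eq_regRep_of_mem_centralizer_companion`) — i.e. the
per-`t` binder `hpos` OF RECORD (A-p13 (g32) 12:22:10Z ∕ (B6-H) ED. 2) holds VERBATIM for `((ĝ,1) t₀ (ĝ,1)⁻¹, ĝ·P, d)` and `(c u₀, c² v₀)`.  No class-field input: the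
norm∕similitude question of a FIXED datum (two `U_w`-classes when `−1 ∈ N L_w^×`) never arises because the datum is rescaled by the unit `c`.

* `valued_eq_exp_neg_one_of_norm` (`|v₀| = |ϖ_v|`), `galAdicCompletionMap_apply_mul_self_eq_one` (`σ_w (dᵢ)_w · (dᵢ)_w = 1`),
  **`exists_conj_standardPosition`** (the head; output = `∃ ĝ c, |c| = 1 ∧ ∀ t ∈ Z((ĝ,1) t₀ (ĝ,1)⁻¹), ∃ s γ a b, ↑γ = (a, b·(c²v₀); b, a + b·(c u₀)) ∧ diag(1,α)·↑(E₂ t.1)·diag(1,α⁻¹) = s·ι(γ)`).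

## References
* [LabesseLanglands1979] J.-P. Labesse, R. P. Langlands, *L-indistinguishability for SL(2)*, Canad. J. Math. 31 (1979): §2 p. 7 (the torus `a + bτ`, orders `𝒪 + ϖ^m 𝒪_E`).
* [Serre1980Trees] J.-P. Serre, *Trees* (1980), Ch. II §1.2–§1.3 (`GL₂`∕`SL₂`∕`PGL₂` of a local field acting on the tree).
* [Rogawski1990] J. D. Rogawski, *Automorphic Representations of Unitary Groups in Three Variables*, Ann. of Math. Stud. 123 (1990): §3.6 p. 31 (`U(1,1)`), §4.9 p. 54.
* [Serre1979] J.-P. Serre, *Local Fields*, GTM 67 (1979): Ch. I §6 Prop. 18 (Eisenstein equations of uniformisers).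
* [CasselsFrohlichANT1967] J. W. S. Cassels, A. Fröhlich (eds.), *Algebraic Number Theory* (1967): Ch. VII §1.1 (`σ ⊗ 1` on `L ⊗ L⁺_v`).
-/

set_option autoImplicit false

noncomputable section

open Matrix NumberField IsDedekindDomain
open scoped Matrix MatrixGroups

namespace Literature.NumberTheory.Rogawski1990

open Literature.NumberTheory.Automorphic Literature.NumberTheory.Automorphic.UnitaryGroup Literature.NumberTheory.GaloisRepresentations

section StandardPosition

variable (L : Type) [Field L] [NumberField L] [IsCMField L] (v : HeightOneSpectrum (𝓞 ↥(maximalRealSubfield L)))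
  (w : PlacesOver L v) (hw : IsCMField.complexConj L • w.1 = w.1) (he : v.asIdeal.ramificationIdx' w.1.asIdeal ≠ 1)

include he in
/-- At a ramified place, `|v₀| = |ϖ_v|` for a quadratic datum `(τ; u₀, v₀)` with `τ` a uniformiser: `|ι v₀| = |τ στ| = |τ|²`, `|ι y| = |y|²`. [cite: Serre1979, Ch. I §6 Prop. 18] -/
theorem valued_eq_exp_neg_one_of_norm {τ : w.1.adicCompletion L} {v₀ : v.adicCompletion ↥(maximalRealSubfield L)} (hτ : Valued.v τ = WithZero.exp (-1 : ℤ))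
    (hnm : τ * galAdicCompletionMap (L := L) (IsCMField.complexConj L) hw τ = -toPlace v w v₀) : Valued.v v₀ = WithZero.exp (-1 : ℤ) := by
  have h1 : Valued.v (toPlace v w v₀) = WithZero.exp (-1 : ℤ) ^ 2 := by
    rw [← Valuation.map_neg, ← hnm, Valuation.map_mul, valued_galAdicCompletionMap, hτ, pow_two]
  rw [valued_toPlace_eq_sq_of_ramified L v w hw he] at h1
  exact eq_of_sq_eq_sq h1

include hw in
/-- `σ_w (d_w) · d_w = 1` for the place components of a `conjLocal`-norm-one family. [cite: CasselsFrohlichANT1967, Ch. VII §1.1] -/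
theorem galAdicCompletionMap_apply_mul_self_eq_one {d : Fin 2 → LocalRing L v} (hd1 : ∀ i, conjLocal L (IsCMField.complexConj L) v (d i) * d i = 1) (i : Fin 2) :
    galAdicCompletionMap (L := L) (IsCMField.complexConj L) hw (d i w) * d i w = 1 := by
  have h := congrArg (fun x : LocalRing L v => x w) (hd1 i)
  simpa only [Pi.mul_apply, Pi.one_apply, conjLocal_apply_eq_galAdicCompletionMap L v w hw] using h

include he in
-- `L_w`-sized statement: elaboration budget only (no search)
set_option maxHeartbeats 1600000 in
/-- **(B6-P)(P1) — EXISTENCE OF THE STANDARD-POSITION CONJUGATOR.**  At a RAMIFIED non-split place `w ∣ v` of the CM field `L`, for every elliptic regular frame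
`(t₀, P, d)` of `H_v = U(Φ₂)_v × U(Φ₁)_v` (`t₀.1` regular, `t₀.1 P = P diag(d)`, `c(dᵢ) dᵢ = 1`), every one-place model `E₂ : U(Φ₂)_v ≃ U_w` over ★ `localNonsplitEquiv`, every skew
`α ∈ L_w` and every quadratic datum `(τ; u₀, v₀)` with `τ` a uniformiser (`τ + σ_w τ = ι u₀`, `τ σ_w τ = −ι v₀`; B-p17 (g25) ★ `exists_eisensteinBasis_of_ramified`), there are
`ĝ ∈ U(Φ₂)_v` and a UNIT `c ∈ L⁺_v` such that the conjugated torus `Z((ĝ,1) t₀ (ĝ,1)⁻¹)` is in STANDARD POSITION for the RESCALED datum `(ι c·τ; c u₀, c² v₀)`: for every `t`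
in it, `diag(1,α) · E₂(t.1) · diag(1,α)⁻¹ = s · ι(γ)` with `γ = (a, b c² v₀; b, a + b c u₀)` in Labesse–Langlands' torus — the `hpos` binder of (B6-H) ★ A-p13 (g32) ∕ (B6)
F0P3-p01 (g14), VERBATIM up to the datum.  Proof: ★ `exists_gl_conj_eq_torus` on the descent of `E₂ t₀.1` (eigenframe `P_w`, eigenvalues `(dᵢ)_w`), twist by `γ_τ^k`,
`k = log|det h|` (`|det γ_τ| = |v₀| = |ϖ_v|`) to make `c := det` a unit, ★ `exists_gl_det_one_conj_eq_torus_rescale`, unitary lift ★ `exists_mem_unitaryGroupOfForm_conj_descent_eq`,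
`ĝ := E₂⁻¹ z`; an element commuting with `(ĝ,1) t₀ (ĝ,1)⁻¹` has descent commuting with `a + b′ γ′` (`b′ ≠ 0`), hence with `γ′ = (0, c²v₀; 1, c u₀)`, hence of torus shape
(★ A-p01 `exists_coe_eq_regRep_of_mem_centralizer_companion`).  No class-field input; the similitude∕norm question never arises.
[cite: LabesseLanglands1979, §2 p. 7] [cite: Serre1980Trees, Ch. II §1.2–§1.3] [cite: Rogawski1990, §3.6 p. 31; §4.9 p. 54] -/
theorem exists_conj_standardPosition
    {α : w.1.adicCompletion L} (hα : galAdicCompletionMap (L := L) (IsCMField.complexConj L) hw α = -α) (hα0 : α ≠ 0)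
    {τ : w.1.adicCompletion L} {u₀ v₀ : v.adicCompletion ↥(maximalRealSubfield L)} (hτ : Valued.v τ = WithZero.exp (-1 : ℤ))
    (htr : τ + galAdicCompletionMap (L := L) (IsCMField.complexConj L) hw τ = toPlace v w u₀)
    (hnm : τ * galAdicCompletionMap (L := L) (IsCMField.complexConj L) hw τ = -toPlace v w v₀)
    (E₂ : (cmDatum L 2 (Matrix.of fun i j : Fin 2 => if i.val + j.val + 1 = 2 then (1 : L) else 0)).Local v ≃ₜ*
      ↥(unitaryGroupOfForm (galAdicCompletionMap (L := L) (IsCMField.complexConj L) hw) (placeForm (Matrix.of fun i j : Fin 2 => if i.val + j.val + 1 = 2 then (1 : L) else 0) w.1)))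
    (hE₂ : ∀ g, ((E₂ g : ↥(unitaryGroupOfForm (galAdicCompletionMap (L := L) (IsCMField.complexConj L) hw) (placeForm (Matrix.of fun i j : Fin 2 => if i.val + j.val + 1 = 2 then (1 : L) else 0) w.1))) : GL (Fin 2) (w.1.adicCompletion L)) =
      (((localNonsplitEquiv (IsCMField.complexConj L) (Matrix.of fun i j : Fin 2 => if i.val + j.val + 1 = 2 then (1 : L) else 0) (IsCMField.complexConj_ne_one L) w hw) g :
        ↥(unitaryGroupOfForm (galAdicCompletionMap (L := L) (IsCMField.complexConj L) hw) (placeForm (Matrix.of fun i j : Fin 2 => if i.val + j.val + 1 = 2 then (1 : L) else 0) w.1))) : GL (Fin 2) (w.1.adicCompletion L)))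
    (t₀ : ((cmDatum L 2 (Matrix.of fun i j : Fin 2 => if i.val + j.val + 1 = 2 then (1 : L) else 0)).Local v × (cmDatum L 1 (Matrix.of fun i j : Fin 1 => if i.val + j.val + 1 = 1 then (1 : L) else 0)).Local v))
    (P : GL (Fin 2) (LocalRing L v)) (d : Fin 2 → (LocalRing L v)) (ht₀ : IsRegularElt (t₀.1.val : GL (Fin 2) (LocalRing L v)))
    (hP : (t₀.1.val.val : Matrix (Fin 2) (Fin 2) (LocalRing L v)) * P.val = P.val * Matrix.diagonal d) (hd1 : ∀ i, conjLocal L (IsCMField.complexConj L) v (d i) * d i = 1) :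
    ∃ (ĝ : (cmDatum L 2 (Matrix.of fun i j : Fin 2 => if i.val + j.val + 1 = 2 then (1 : L) else 0)).Local v) (c : v.adicCompletion ↥(maximalRealSubfield L)), Valued.v c = 1 ∧
      ∀ t : ↥(Subgroup.centralizer ({((ĝ, 1) : ((cmDatum L 2 (Matrix.of fun i j : Fin 2 => if i.val + j.val + 1 = 2 then (1 : L) else 0)).Local v × (cmDatum L 1 (Matrix.of fun i j : Fin 1 => if i.val + j.val + 1 = 1 then (1 : L) else 0)).Local v)) * t₀ * ((ĝ, 1) : ((cmDatum L 2 (Matrix.of fun i j : Fin 2 => if i.val + j.val + 1 = 2 then (1 : L) else 0)).Local v × (cmDatum L 1 (Matrix.of fun i j : Fin 1 => if i.val + j.val + 1 = 1 then (1 : L) else 0)).Local v))⁻¹} : Set ((cmDatum L 2 (Matrix.of fun i j : Fin 2 => if i.val + j.val + 1 = 2 then (1 : L) else 0)).Local v × (cmDatum L 1 (Matrix.of fun i j : Fin 1 => if i.val + j.val + 1 = 1 then (1 : L) else 0)).Local v))),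
        ∃ (s : w.1.adicCompletion L) (γ : GL (Fin 2) (v.adicCompletion ↥(maximalRealSubfield L))) (a b : v.adicCompletion ↥(maximalRealSubfield L)),
          (γ : Matrix (Fin 2) (Fin 2) (v.adicCompletion ↥(maximalRealSubfield L))) = !![a, b * (c ^ 2 * v₀); b, a + b * (c * u₀)] ∧
          Matrix.diagonal ![1, α] * (((E₂ (t : ((cmDatum L 2 (Matrix.of fun i j : Fin 2 => if i.val + j.val + 1 = 2 then (1 : L) else 0)).Local v × (cmDatum L 1 (Matrix.of fun i j : Fin 1 => if i.val + j.val + 1 = 1 then (1 : L) else 0)).Local v)).1 : ↥(unitaryGroupOfForm (galAdicCompletionMap (L := L) (IsCMField.complexConj L) hw) (placeForm (Matrix.of fun i j : Fin 2 => if i.val + j.val + 1 = 2 then (1 : L) else 0) w.1))) : GL (Fin 2) (w.1.adicCompletion L)) : Matrix (Fin 2) (Fin 2) (w.1.adicCompletion L)) * Matrix.diagonal ![1, α⁻¹] =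
            s • (γ : Matrix (Fin 2) (Fin 2) (v.adicCompletion ↥(maximalRealSubfield L))).map (toPlace v w) := by
  -- abbreviations for the place data
  have hσι : ∀ x, galAdicCompletionMap (L := L) (IsCMField.complexConj L) hw (toPlace v w x) = toPlace v w x :=
    fun x => galAdicCompletionMap_toPlace (IsCMField.complexConj L) w w hw x
  have hfix : ∀ z : w.1.adicCompletion L, galAdicCompletionMap (L := L) (IsCMField.complexConj L) hw z = z → ∃ x, toPlace v w x = z :=
    fun z hz => exists_toPlace_eq_of_galAdicCompletionMap_eq (IsCMField.complexConj L) w (IsCMField.complexConj_ne_one L) hw z hz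
  have hbasis : ∀ z : w.1.adicCompletion L, ∃ p q : v.adicCompletion ↥(maximalRealSubfield L), z = toPlace v w p + toPlace v w q * τ :=
    exists_eq_toPlace_add_toPlace_mul L v w hw he hτ
  -- the element `y := E₂ t₀.1 ∈ U(σ_w, (0 1; 1 0))` and its descent
  have hy : ((E₂ t₀.1 : ↥(unitaryGroupOfForm (galAdicCompletionMap (L := L) (IsCMField.complexConj L) hw) (placeForm (Matrix.of fun i j : Fin 2 => if i.val + j.val + 1 = 2 then (1 : L) else 0) w.1))) : GL (Fin 2) (w.1.adicCompletion L)) ∈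
      unitaryGroupOfForm (galAdicCompletionMap (L := L) (IsCMField.complexConj L) hw) !![(0 : w.1.adicCompletion L), 1; 1, 0] := by
    rw [← unitaryGroupOfForm_placeForm_antidiagTwo_eq L v w]; exact (E₂ t₀.1).2
  obtain ⟨s, g₀, hs0, hdesc⟩ := descent_of_mem_unitaryGroupOfForm_antidiag L v w hw hα hα0 _ hy
  -- the eigenframe of `y` at `w`: `P_w`, eigenvalues `(d i)_w`, distinct, of norm one
  have ht₀Z : t₀ ∈ Subgroup.centralizer ({t₀} : Set ((cmDatum L 2 (Matrix.of fun i j : Fin 2 => if i.val + j.val + 1 = 2 then (1 : L) else 0)).Local v × (cmDatum L 1 (Matrix.of fun i j : Fin 1 => if i.val + j.val + 1 = 1 then (1 : L) else 0)).Local v)) := Subgroup.mem_centralizer_singleton_iff.2 rfl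
  have hτd : ∀ i : Fin 2, ((P⁻¹).val * (((⟨t₀, ht₀Z⟩ : ↥(Subgroup.centralizer ({t₀} : Set ((cmDatum L 2 (Matrix.of fun i j : Fin 2 => if i.val + j.val + 1 = 2 then (1 : L) else 0)).Local v × (cmDatum L 1 (Matrix.of fun i j : Fin 1 => if i.val + j.val + 1 = 1 then (1 : L) else 0)).Local v)))) : ((cmDatum L 2 (Matrix.of fun i j : Fin 2 => if i.val + j.val + 1 = 2 then (1 : L) else 0)).Local v × (cmDatum L 1 (Matrix.of fun i j : Fin 1 => if i.val + j.val + 1 = 1 then (1 : L) else 0)).Local v)).1.val.val : Matrix (Fin 2) (Fin 2) (LocalRing L v)) * P.val) i i = d i := by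
    intro i
    have h : (P⁻¹).val * (((⟨t₀, ht₀Z⟩ : ↥(Subgroup.centralizer ({t₀} : Set ((cmDatum L 2 (Matrix.of fun i j : Fin 2 => if i.val + j.val + 1 = 2 then (1 : L) else 0)).Local v × (cmDatum L 1 (Matrix.of fun i j : Fin 1 => if i.val + j.val + 1 = 1 then (1 : L) else 0)).Local v)))) : ((cmDatum L 2 (Matrix.of fun i j : Fin 2 => if i.val + j.val + 1 = 2 then (1 : L) else 0)).Local v × (cmDatum L 1 (Matrix.of fun i j : Fin 1 => if i.val + j.val + 1 = 1 then (1 : L) else 0)).Local v)).1.val.val : Matrix (Fin 2) (Fin 2) (LocalRing L v)) * P.val = Matrix.diagonal d := by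
      rw [Matrix.mul_assoc, show (((⟨t₀, ht₀Z⟩ : ↥(Subgroup.centralizer ({t₀} : Set ((cmDatum L 2 (Matrix.of fun i j : Fin 2 => if i.val + j.val + 1 = 2 then (1 : L) else 0)).Local v × (cmDatum L 1 (Matrix.of fun i j : Fin 1 => if i.val + j.val + 1 = 1 then (1 : L) else 0)).Local v)))) : ((cmDatum L 2 (Matrix.of fun i j : Fin 2 => if i.val + j.val + 1 = 2 then (1 : L) else 0)).Local v × (cmDatum L 1 (Matrix.of fun i j : Fin 1 => if i.val + j.val + 1 = 1 then (1 : L) else 0)).Local v)).1.val.val : Matrix (Fin 2) (Fin 2) (LocalRing L v)) = t₀.1.val.val from rfl, hP, ← Matrix.mul_assoc,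
        show (P⁻¹).val * P.val = 1 from P.inv_mul, Matrix.one_mul]
    rw [h, Matrix.diagonal_apply_eq]
  have hd01 : d 0 ≠ d 1 := by
    have h := (isRegularElt_iff_frameEntry_ne L v w hw t₀ P d ht₀ hP hd1 ⟨t₀, ht₀Z⟩).1 ht₀
    rwa [hτd 0, hτd 1] at h
  have hd01w : d 0 w ≠ d 1 w := fun h => hd01 ((LocalRing.eq_iff_apply_eq (IsCMField.complexConj L) (IsCMField.complexConj_ne_one L) w hw _ _).2 h)
  have hd1w : ∀ i, galAdicCompletionMap (L := L) (IsCMField.complexConj L) hw ((fun i => d i w) i) * (fun i => d i w) i = 1 :=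
    fun i => galAdicCompletionMap_apply_mul_self_eq_one L v w hw hd1 i
  have hPw : (((E₂ t₀.1 : ↥(unitaryGroupOfForm (galAdicCompletionMap (L := L) (IsCMField.complexConj L) hw) (placeForm (Matrix.of fun i j : Fin 2 => if i.val + j.val + 1 = 2 then (1 : L) else 0) w.1))) : GL (Fin 2) (w.1.adicCompletion L)) : Matrix (Fin 2) (Fin 2) (w.1.adicCompletion L)) * ((((Matrix.GeneralLinearGroup.map (Pi.evalRingHom (fun w' : PlacesOver L v => w'.1.adicCompletion L) w) P) : GL (Fin 2) (w.1.adicCompletion L)) : GL (Fin 2) (w.1.adicCompletion L)) : Matrix (Fin 2) (Fin 2) (w.1.adicCompletion L)) =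
      ((((Matrix.GeneralLinearGroup.map (Pi.evalRingHom (fun w' : PlacesOver L v => w'.1.adicCompletion L) w) P) : GL (Fin 2) (w.1.adicCompletion L)) : GL (Fin 2) (w.1.adicCompletion L)) : Matrix (Fin 2) (Fin 2) (w.1.adicCompletion L)) * Matrix.diagonal (fun i => d i w) := by
    have h := coe_localNonsplitEquiv_mul_map_eq L v w hw t₀.1 P (Matrix.diagonal d) hP
    rw [hE₂, h, Matrix.diagonal_map (map_zero _)]
    rfl
  have hQ : ((((Matrix.GeneralLinearGroup.map (Pi.evalRingHom (fun w' : PlacesOver L v => w'.1.adicCompletion L) w) P) : GL (Fin 2) (w.1.adicCompletion L)) : GL (Fin 2) (w.1.adicCompletion L)) : Matrix (Fin 2) (Fin 2) (w.1.adicCompletion L)).det ≠ 0 :=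
    ((Matrix.GeneralLinearGroup.map (Pi.evalRingHom (fun w' : PlacesOver L v => w'.1.adicCompletion L) w) P).isUnit.map Matrix.detMonoidHom).ne_zero
  -- ★ generic: the descent `g₀` is conjugate into the torus of `(τ; u₀, v₀)`
  obtain ⟨h, a, b, hb, hh⟩ := exists_gl_conj_eq_torus (toPlace v w) (galAdicCompletionMap (L := L) (IsCMField.complexConj L) hw) hσι hfix hα hα0 htr hnm hbasis hy hs0 hdesc hQ hPw hd01w hd1w
  -- `γ_τ` as a unit; `|det γ_τ| = |v₀| = |ϖ_v|`
  have hv0 : Valued.v v₀ = WithZero.exp (-1 : ℤ) := valued_eq_exp_neg_one_of_norm L v w hw he hτ hnm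
  have hv00 : v₀ ≠ 0 := by intro h0; rw [h0, Valuation.map_zero] at hv0; exact WithZero.zero_ne_coe hv0
  have hγdet : (!![0, v₀; 1, u₀] : Matrix (Fin 2) (Fin 2) (v.adicCompletion ↥(maximalRealSubfield L))).det ≠ 0 := by
    rw [Matrix.det_fin_two_of]; simpa using hv00
  set γτ : GL (Fin 2) (v.adicCompletion ↥(maximalRealSubfield L)) := Matrix.GeneralLinearGroup.mkOfDetNeZero _ hγdet with hγτdef
  have hγτ : (γτ : Matrix (Fin 2) (Fin 2) (v.adicCompletion ↥(maximalRealSubfield L))) = !![0, v₀; 1, u₀] := rfl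
  have hvγ : Valued.v (γτ : Matrix (Fin 2) (Fin 2) (v.adicCompletion ↥(maximalRealSubfield L))).det = WithZero.exp (-1 : ℤ) := by
    rw [hγτ, Matrix.det_fin_two_of, zero_mul, zero_sub, mul_one, Valuation.map_neg, hv0]
  -- twist: `h₂ := γ_τ^k h` with `k := log |det h|`, so that `|det h₂| = 1`
  set k : ℤ := WithZero.log (Valued.v (h : Matrix (Fin 2) (Fin 2) (v.adicCompletion ↥(maximalRealSubfield L))).det) with hkdef
  have hdeth : Valued.v (h : Matrix (Fin 2) (Fin 2) (v.adicCompletion ↥(maximalRealSubfield L))).det ≠ 0 :=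
    (Valuation.ne_zero_iff _).2 (h.isUnit.map Matrix.detMonoidHom).ne_zero
  have hh₂ := gl_mul_conj_eq_of_conj_eq hh (companion_zpow_mul_torus_comm hγτ a b k)
  have hc1 : Valued.v (((γτ ^ k * h : GL (Fin 2) (v.adicCompletion ↥(maximalRealSubfield L))) : Matrix (Fin 2) (Fin 2) (v.adicCompletion ↥(maximalRealSubfield L))).det) = 1 := by
    have hdetpow : (((γτ ^ k : GL (Fin 2) (v.adicCompletion ↥(maximalRealSubfield L))) : Matrix (Fin 2) (Fin 2) (v.adicCompletion ↥(maximalRealSubfield L))).det) =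
        ((γτ : Matrix (Fin 2) (Fin 2) (v.adicCompletion ↥(maximalRealSubfield L))).det) ^ k := by
      rw [← Matrix.GeneralLinearGroup.val_det_apply, map_zpow, Units.val_zpow_eq_zpow_val, Matrix.GeneralLinearGroup.val_det_apply]
    rw [Units.val_mul, Matrix.det_mul, Valuation.map_mul, hdetpow, map_zpow₀, hvγ, ← WithZero.exp_zsmul, ← WithZero.exp_log hdeth, ← hkdef, ← WithZero.exp_add,
      smul_eq_mul, mul_neg, mul_one, neg_add_cancel, WithZero.exp_zero]
  -- rescale to determinant one; `c := det h₂` is a unit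
  obtain ⟨h', hdet', hh'⟩ := exists_gl_det_one_conj_eq_torus_rescale hh₂
  set c : v.adicCompletion ↥(maximalRealSubfield L) := (((γτ ^ k * h : GL (Fin 2) (v.adicCompletion ↥(maximalRealSubfield L))) : Matrix (Fin 2) (Fin 2) (v.adicCompletion ↥(maximalRealSubfield L))).det) with hcdef
  have hc0 : c ≠ 0 := by intro h0; rw [h0, Valuation.map_zero] at hc1; exact zero_ne_one hc1
  -- the unitary lift `z` and its effect on the descent
  obtain ⟨z, hz⟩ := exists_mem_unitaryGroupOfForm_conj_descent_eq (toPlace v w) (galAdicCompletionMap (L := L) (IsCMField.complexConj L) hw) hσι hα hα0 hdesc hdet'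
  rw [hh'] at hz
  -- `ĝ := E₂⁻¹ z`
  set zU : ↥(unitaryGroupOfForm (galAdicCompletionMap (L := L) (IsCMField.complexConj L) hw) (placeForm (Matrix.of fun i j : Fin 2 => if i.val + j.val + 1 = 2 then (1 : L) else 0) w.1)) :=
    Subgroup.inclusion (unitaryGroupOfForm_placeForm_antidiagTwo_eq L v w (galAdicCompletionMap (L := L) (IsCMField.complexConj L) hw)).ge z with hzUdef
  have hzU : ((zU : ↥(unitaryGroupOfForm (galAdicCompletionMap (L := L) (IsCMField.complexConj L) hw) (placeForm (Matrix.of fun i j : Fin 2 => if i.val + j.val + 1 = 2 then (1 : L) else 0) w.1))) : GL (Fin 2) (w.1.adicCompletion L)) = (z : GL (Fin 2) (w.1.adicCompletion L)) := by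
    rw [hzUdef, Subgroup.coe_inclusion]
  refine ⟨E₂.symm zU, c, hc1, fun t => ?_⟩
  -- `E₂` of the conjugated generator
  have hgen : (E₂ ((((E₂.symm zU, 1) : ((cmDatum L 2 (Matrix.of fun i j : Fin 2 => if i.val + j.val + 1 = 2 then (1 : L) else 0)).Local v × (cmDatum L 1 (Matrix.of fun i j : Fin 1 => if i.val + j.val + 1 = 1 then (1 : L) else 0)).Local v)) * t₀ * ((E₂.symm zU, 1) : ((cmDatum L 2 (Matrix.of fun i j : Fin 2 => if i.val + j.val + 1 = 2 then (1 : L) else 0)).Local v × (cmDatum L 1 (Matrix.of fun i j : Fin 1 => if i.val + j.val + 1 = 1 then (1 : L) else 0)).Local v))⁻¹).1) : GL (Fin 2) (w.1.adicCompletion L)) =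
      (z : GL (Fin 2) (w.1.adicCompletion L)) * ((E₂ t₀.1 : ↥(unitaryGroupOfForm (galAdicCompletionMap (L := L) (IsCMField.complexConj L) hw) (placeForm (Matrix.of fun i j : Fin 2 => if i.val + j.val + 1 = 2 then (1 : L) else 0) w.1))) : GL (Fin 2) (w.1.adicCompletion L)) * (z : GL (Fin 2) (w.1.adicCompletion L))⁻¹ := by
    have h1 : (((E₂.symm zU, 1) : ((cmDatum L 2 (Matrix.of fun i j : Fin 2 => if i.val + j.val + 1 = 2 then (1 : L) else 0)).Local v × (cmDatum L 1 (Matrix.of fun i j : Fin 1 => if i.val + j.val + 1 = 1 then (1 : L) else 0)).Local v)) * t₀ * ((E₂.symm zU, 1) : ((cmDatum L 2 (Matrix.of fun i j : Fin 2 => if i.val + j.val + 1 = 2 then (1 : L) else 0)).Local v × (cmDatum L 1 (Matrix.of fun i j : Fin 1 => if i.val + j.val + 1 = 1 then (1 : L) else 0)).Local v))⁻¹).1 = E₂.symm zU * t₀.1 * (E₂.symm zU)⁻¹ := rfl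
    rw [h1, map_mul, map_mul, map_inv, E₂.apply_symm_apply, Subgroup.coe_mul, Subgroup.coe_mul, Subgroup.coe_inv, hzU]
  -- the element `t` of the conjugated torus: its descent, and the commutation with the generator
  have hyt : ((E₂ (t : ((cmDatum L 2 (Matrix.of fun i j : Fin 2 => if i.val + j.val + 1 = 2 then (1 : L) else 0)).Local v × (cmDatum L 1 (Matrix.of fun i j : Fin 1 => if i.val + j.val + 1 = 1 then (1 : L) else 0)).Local v)).1 : ↥(unitaryGroupOfForm (galAdicCompletionMap (L := L) (IsCMField.complexConj L) hw) (placeForm (Matrix.of fun i j : Fin 2 => if i.val + j.val + 1 = 2 then (1 : L) else 0) w.1))) : GL (Fin 2) (w.1.adicCompletion L)) ∈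
      unitaryGroupOfForm (galAdicCompletionMap (L := L) (IsCMField.complexConj L) hw) !![(0 : w.1.adicCompletion L), 1; 1, 0] := by
    rw [← unitaryGroupOfForm_placeForm_antidiagTwo_eq L v w]; exact (E₂ (t : ((cmDatum L 2 (Matrix.of fun i j : Fin 2 => if i.val + j.val + 1 = 2 then (1 : L) else 0)).Local v × (cmDatum L 1 (Matrix.of fun i j : Fin 1 => if i.val + j.val + 1 = 1 then (1 : L) else 0)).Local v)).1).2
  obtain ⟨st, gt, hst0, hdesct⟩ := descent_of_mem_unitaryGroupOfForm_antidiag L v w hw hα hα0 _ hyt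
  have hcommH := (Subgroup.mem_centralizer_iff.1 t.2) _ (Set.mem_singleton _)
  have hcomm1 : (((E₂.symm zU, 1) : ((cmDatum L 2 (Matrix.of fun i j : Fin 2 => if i.val + j.val + 1 = 2 then (1 : L) else 0)).Local v × (cmDatum L 1 (Matrix.of fun i j : Fin 1 => if i.val + j.val + 1 = 1 then (1 : L) else 0)).Local v)) * t₀ * ((E₂.symm zU, 1) : ((cmDatum L 2 (Matrix.of fun i j : Fin 2 => if i.val + j.val + 1 = 2 then (1 : L) else 0)).Local v × (cmDatum L 1 (Matrix.of fun i j : Fin 1 => if i.val + j.val + 1 = 1 then (1 : L) else 0)).Local v))⁻¹).1 * (t : ((cmDatum L 2 (Matrix.of fun i j : Fin 2 => if i.val + j.val + 1 = 2 then (1 : L) else 0)).Local v × (cmDatum L 1 (Matrix.of fun i j : Fin 1 => if i.val + j.val + 1 = 1 then (1 : L) else 0)).Local v)).1 = (t : ((cmDatum L 2 (Matrix.of fun i j : Fin 2 => if i.val + j.val + 1 = 2 then (1 : L) else 0)).Local v × (cmDatum L 1 (Matrix.of fun i j : Fin 1 => if i.val + j.val + 1 = 1 then (1 : L) else 0)).Local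 v)).1 * (((E₂.symm zU, 1) : ((cmDatum L 2 (Matrix.of fun i j : Fin 2 => if i.val + j.val + 1 = 2 then (1 : L) else 0)).Local v × (cmDatum L 1 (Matrix.of fun i j : Fin 1 => if i.val + j.val + 1 = 1 then (1 : L) else 0)).Local v)) * t₀ * ((E₂.symm zU, 1) : ((cmDatum L 2 (Matrix.of fun i j : Fin 2 => if i.val + j.val + 1 = 2 then (1 : L) else 0)).Local v × (cmDatum L 1 (Matrix.of fun i j : Fin 1 => if i.val + j.val + 1 = 1 then (1 : L) else 0)).Local v))⁻¹).1 := congrArg Prod.fst hcommH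
  have hcomm2 := congrArg (fun x => ((E₂ x : ↥(unitaryGroupOfForm (galAdicCompletionMap (L := L) (IsCMField.complexConj L) hw) (placeForm (Matrix.of fun i j : Fin 2 => if i.val + j.val + 1 = 2 then (1 : L) else 0) w.1))) : GL (Fin 2) (w.1.adicCompletion L))) hcomm1
  simp only [map_mul, Subgroup.coe_mul] at hcomm2
  rw [hgen] at hcomm2
  -- conjugate the commutation by `diag(1,α)` and read it on the descents
  set D : Matrix (Fin 2) (Fin 2) (w.1.adicCompletion L) := Matrix.diagonal ![1, α] with hDdef
  set D' : Matrix (Fin 2) (Fin 2) (w.1.adicCompletion L) := Matrix.diagonal ![1, α⁻¹] with hD'def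
  set Mg : Matrix (Fin 2) (Fin 2) (w.1.adicCompletion L) := ((((z : GL (Fin 2) (w.1.adicCompletion L)) * ((E₂ t₀.1 : ↥(unitaryGroupOfForm (galAdicCompletionMap (L := L) (IsCMField.complexConj L) hw) (placeForm (Matrix.of fun i j : Fin 2 => if i.val + j.val + 1 = 2 then (1 : L) else 0) w.1))) : GL (Fin 2) (w.1.adicCompletion L)) * (z : GL (Fin 2) (w.1.adicCompletion L))⁻¹ : GL (Fin 2) (w.1.adicCompletion L)) : Matrix (Fin 2) (Fin 2) (w.1.adicCompletion L))) with hMgdef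
  set Mt : Matrix (Fin 2) (Fin 2) (w.1.adicCompletion L) := (((E₂ (t : ((cmDatum L 2 (Matrix.of fun i j : Fin 2 => if i.val + j.val + 1 = 2 then (1 : L) else 0)).Local v × (cmDatum L 1 (Matrix.of fun i j : Fin 1 => if i.val + j.val + 1 = 1 then (1 : L) else 0)).Local v)).1 : ↥(unitaryGroupOfForm (galAdicCompletionMap (L := L) (IsCMField.complexConj L) hw) (placeForm (Matrix.of fun i j : Fin 2 => if i.val + j.val + 1 = 2 then (1 : L) else 0) w.1))) : GL (Fin 2) (w.1.adicCompletion L)) : Matrix (Fin 2) (Fin 2) (w.1.adicCompletion L)) with hMtdef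
  have hcommM : Mg * Mt = Mt * Mg :=
    congrArg (fun u : GL (Fin 2) (w.1.adicCompletion L) => (u : Matrix (Fin 2) (Fin 2) (w.1.adicCompletion L))) hcomm2
  have hconjcomm : (D * Mg * D') * (D * Mt * D') = (D * Mt * D') * (D * Mg * D') := by
    calc (D * Mg * D') * (D * Mt * D') = D * Mg * (D' * D) * Mt * D' := by simp only [Matrix.mul_assoc]
      _ = D * (Mg * Mt) * D' := by rw [hD'def, hDdef, diagonal_inv_mul_diagonal hα0]; simp only [Matrix.mul_assoc, Matrix.one_mul]
      _ = D * (Mt * Mg) * D' := by rw [hcommM]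
      _ = D * Mt * (D' * D) * Mg * D' := by rw [hD'def, hDdef, diagonal_inv_mul_diagonal hα0]; simp only [Matrix.mul_assoc, Matrix.one_mul]
      _ = (D * Mt * D') * (D * Mg * D') := by simp only [Matrix.mul_assoc]
  rw [hz, hdesct] at hconjcomm
  simp only [Matrix.smul_mul, Matrix.mul_smul, smul_smul, ← Matrix.map_mul] at hconjcomm
  rw [mul_comm st s] at hconjcomm
  have hss : s * st ≠ 0 := mul_ne_zero hs0 hst0
  have hmapcomm := Matrix.map_injective (toPlace v w).injective (smul_right_injective (Matrix (Fin 2) (Fin 2) (w.1.adicCompletion L)) hss hconjcomm)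
  -- `gt` commutes with the torus element `a·1 + b′·γ′`, hence with `γ′`
  set b' : v.adicCompletion ↥(maximalRealSubfield L) := b / ((((γτ ^ k * h : GL (Fin 2) (v.adicCompletion ↥(maximalRealSubfield L))) : Matrix (Fin 2) (Fin 2) (v.adicCompletion ↥(maximalRealSubfield L))).det)) with hb'def
  have hb' : b' ≠ 0 := div_ne_zero hb hc0
  have hγ'det : (!![0, c ^ 2 * v₀; 1, c * u₀] : Matrix (Fin 2) (Fin 2) (v.adicCompletion ↥(maximalRealSubfield L))).det ≠ 0 := by
    rw [Matrix.det_fin_two_of]; simpa using And.intro hc0 hv00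
  set γ' : GL (Fin 2) (v.adicCompletion ↥(maximalRealSubfield L)) := Matrix.GeneralLinearGroup.mkOfDetNeZero _ hγ'det with hγ'def
  have hγ' : (γ' : Matrix (Fin 2) (Fin 2) (v.adicCompletion ↥(maximalRealSubfield L))) = !![0, c ^ 2 * v₀; 1, c * u₀] := rfl
  have hT : (!![a, b' * (c ^ 2 * v₀); b', a + b' * (c * u₀)] : Matrix (Fin 2) (Fin 2) (v.adicCompletion ↥(maximalRealSubfield L))) =
      a • (1 : Matrix (Fin 2) (Fin 2) (v.adicCompletion ↥(maximalRealSubfield L))) + b' • (γ' : Matrix (Fin 2) (Fin 2) (v.adicCompletion ↥(maximalRealSubfield L))) := by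
    rw [hγ']
    ext i j
    fin_cases i <;> fin_cases j <;> simp
  have hcommγ : (γ' : Matrix (Fin 2) (Fin 2) (v.adicCompletion ↥(maximalRealSubfield L))) * (gt : Matrix (Fin 2) (Fin 2) (v.adicCompletion ↥(maximalRealSubfield L))) =
      (gt : Matrix (Fin 2) (Fin 2) (v.adicCompletion ↥(maximalRealSubfield L))) * (γ' : Matrix (Fin 2) (Fin 2) (v.adicCompletion ↥(maximalRealSubfield L))) := by
    rw [hT, Matrix.mul_add, Matrix.add_mul, Matrix.mul_smul, Matrix.smul_mul, Matrix.mul_one, Matrix.one_mul, Matrix.mul_smul, Matrix.smul_mul] at hmapcomm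
    exact smul_right_injective _ hb' (add_left_cancel hmapcomm)
  have hmem : gt ∈ Subgroup.centralizer ({γ'} : Set (GL (Fin 2) (v.adicCompletion ↥(maximalRealSubfield L)))) := by
    rw [Subgroup.mem_centralizer_iff]
    intro x hx
    rw [Set.mem_singleton_iff] at hx
    subst hx
    exact Units.ext (by rw [Units.val_mul, Units.val_mul, hcommγ])
  obtain ⟨a', e', hgt⟩ := HermitianLatticeTree.exists_coe_eq_regRep_of_mem_centralizer_companion hγ' hmem
  exact ⟨st, gt, a', e', hgt, hdesct⟩

end StandardPosition

end Literature.NumberTheory.Rogawski1990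

end
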